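import Summits.PneNP.PneNP.Theorems.GapMCSPWindowCellZeroFormulas

/-!
# Gap-MCSP window cell `q = 0` (trade-off law) — II. Uniform counting and the silent/flipping variables

Part of the tree landing of HOME/decomp-pnenp-lens-1/TradeOffLaw.lean (sha256 880b490f…, lens-1 g13 of the decomp-pnenp root-decomposition cell; critic NODE-VERDICT 2026-08-30T13:09:32Z CLEARED, landing endorsed (6)(a)):
a SIZE–ACCEPTANCE TRADE-OFF for every `B₂`-circuit on `N` inputs that accepts `0^N` and every point
indicator `e_p` — `N ≤ 9·L·(L + G + 3 − N)`, `L = ⌊log₂ acc⌋`, `G` = number of gates — and its payout: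
the Oliveira–Pich–Santhanam gap problem `Gap-MCSP[2^{βn}/(cn), 2^{βn}]` (census R3) is not separated by
`B₂`-circuit families of eventually `≤ N` gates (`0 < β < 1/3`, every `c ≥ 1`), i.e. the `q = 0` cell of
the window dial of route `route-PneNP-RootDecompMagnificationPayout` (item stmt-PneNP-33309 `WindowCellZero`,
BC5 rung for the attacked item stmt-PneNP-32096). Modules, in dependency order: `…Formulas` (rooted
`B₂`-formulas and additive valuations) → `…Counting` (uniform counting, silent/flipping variables, numeric
helpers) → `…FlipLaw` (the exact acceptance law for read-once formulas) → `…Unfolding` (rooted unfolding of a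
gate list, consistency, references) → `…Potential` (variables/nodes of unfoldings, the root potential: no
duplication across root formulas) → `…Relevance` (relevant roots, link, locality) → `…Product` (boxes, the two
exponent bounds, pigeonhole, the final arithmetic) → `…Count` (`t + 2·nocc ≤ 2G + 3`) → `GapMCSPWindowCellZero`
(the law proved, the payout in tree vocabulary). Proof-internal machinery: nothing here bears on P vs NP
beyond the S-free lower bound it proves; all statements are [folklore]-tagged kernel lemmas of the lens.

THIS FILE (lens §2 second half + §3 preliminaries): `acc f v` (number of inputs where `f = v`), dependence on a
set of coordinates, splicing, INDEPENDENCE of disjointly supported functions, the CYLINDER bound, the BOX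
PRODUCT over a family with pairwise disjoint supports; `0^N`, the indicators `e_p`, silent / flipping
variables of a function, the one-gate transfer `side_bounds`, and the five numeric lemmas (`ℕ` only) that
drive the flip law.
-/

noncomputable section

set_option linter.dupNamespace false -- `Summit.PneNP.PneNP.…`: summit = sub-problem name (D-0017 single-conjunct layout)

namespace Summit.PneNP.PneNP.Theorems.GapMCSPWindowCellZero

open Literature.Computability.Complexity

section Counting

open Finset

variable {N : ℕ}

/-! ### Counting (lineage g12, verbatim up to the environment parameter) -/

/-- Number of assignments on which `f` takes the value `v`. -/
def acc (f : (Fin N → Bool) → Bool) (v : Bool) : ℕ := (univ.filter fun x => f x = v).card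

/-- `f` depends only on the coordinates in `S`. -/
def DependsOn (f : (Fin N → Bool) → Bool) (S : Finset (Fin N)) : Prop :=
  ∀ x y : Fin N → Bool, (∀ i ∈ S, x i = y i) → f x = f y

/-- A formula depends only on the variables it reads. [folklore] -/
theorem BF.dependsOn_eval (ρ : Fin N ⊕ ℕ → Bool) (F : BF N) : DependsOn (F.eval ρ) F.vars :=
  fun _ _ h => F.eval_congr ρ h

/-- Dependence on a set of coordinates is monotone in the set. [folklore] -/
theorem DependsOn.mono {f : (Fin N → Bool) → Bool} {S T : Finset (Fin N)} (h : DependsOn f S)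
    (hST : S ⊆ T) : DependsOn f T := fun x y hxy => h x y (fun i hi => hxy i (hST hi))

/-- Splice: `x` on `S`, `y` off `S`. -/
def mix (S : Finset (Fin N)) (x y : Fin N → Bool) : Fin N → Bool := fun i => if i ∈ S then x i else y i

/-- `mix` takes the first argument on `S`. -/
@[simp] theorem mix_apply_of_mem {S : Finset (Fin N)} {i : Fin N} (hi : i ∈ S) (x y : Fin N → Bool) :
    mix S x y i = x i := by simp [mix, hi]

/-- `mix` takes the second argument off `S`. -/
@[simp] theorem mix_apply_of_not_mem {S : Finset (Fin N)} {i : Fin N} (hi : i ∉ S)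
    (x y : Fin N → Bool) : mix S x y i = y i := by simp [mix, hi]

/-- There are `2^N` assignments to `N` Boolean variables. [folklore] -/
theorem card_univ_fun : (univ : Finset (Fin N → Bool)).card = 2 ^ N := by
  rw [card_univ, Fintype.card_fun, Fintype.card_bool, Fintype.card_fin]

/-- The two value classes of `f` partition the cube: `acc f a + acc f ¬a = 2^N`. [folklore] -/
theorem acc_add_acc_not (f : (Fin N → Bool) → Bool) (a : Bool) : acc f a + acc f (!a) = 2 ^ N := by
  classical
  unfold acc
  have e : (univ.filter fun x : Fin N → Bool => f x = !a) = univ.filter fun x => ¬ f x = a := by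
    refine filter_congr fun x _ => ?_
    cases f x <;> cases a <;> simp
  rw [e, Finset.card_filter_add_card_filter_not, card_univ_fun]

/-- `acc f a ≤ 2^N`. [folklore] -/
theorem acc_le (f : (Fin N → Bool) → Bool) (a : Bool) : acc f a ≤ 2 ^ N := by
  have := acc_add_acc_not f a; omega

/-- Fibres of a map that changes only coordinates in `S` have at most `2^|S|` points. -/
theorem card_filter_fibre_le (S : Finset (Fin N)) (s : Finset (Fin N → Bool))
    (φ : (Fin N → Bool) → (Fin N → Bool)) (hφ : ∀ x, ∀ i ∉ S, φ x i = x i) (z : Fin N → Bool) :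
    (s.filter fun x => φ x = z).card ≤ 2 ^ S.card := by
  classical
  have hcard : (univ : Finset (S → Bool)).card = 2 ^ S.card := by
    rw [card_univ, Fintype.card_fun, Fintype.card_bool, Fintype.card_coe]
  rw [← hcard]
  refine card_le_card_of_injOn (fun x (i : S) => x i.1) (fun _ _ => mem_univ _) ?_
  intro x hx x' hx' hxx'
  simp only [coe_filter, Set.mem_setOf_eq] at hx hx'
  funext i
  by_cases hi : i ∈ S
  · exact congrFun hxx' ⟨i, hi⟩
  · rw [← hφ x i hi, ← hφ x' i hi, hx.2, hx'.2]

/-- **Independence of disjointly supported functions** (uniform counting). -/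
theorem indep {f g : (Fin N → Bool) → Bool} {S T : Finset (Fin N)} (hf : DependsOn f S)
    (hg : DependsOn g T) (hST : Disjoint S T) (a b : Bool) :
    2 ^ N * (univ.filter fun x => f x = a ∧ g x = b).card = acc f a * acc g b := by
  classical
  have hT : ∀ i ∈ T, i ∉ S := fun i hi his => Finset.disjoint_left.1 hST his hi
  have key : ((univ.filter fun x : Fin N → Bool => f x = a ∧ g x = b) ×ˢ
      (univ : Finset (Fin N → Bool))).card =
      ((univ.filter fun x : Fin N → Bool => f x = a) ×ˢ (univ.filter fun x : Fin N → Bool => g x = b)).card := by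
    refine card_bij (fun xy _ => (mix S xy.1 xy.2, mix S xy.2 xy.1)) ?_ ?_ ?_
    · rintro ⟨x, y⟩ hxy
      simp only [mem_product, mem_filter, mem_univ, true_and, and_true] at hxy ⊢
      refine ⟨?_, ?_⟩
      · rw [← hxy.1]; exact hf _ _ (fun i hi => by simp [mix, hi])
      · rw [← hxy.2]; exact hg _ _ (fun i hi => by simp [mix, hT i hi])
    · rintro ⟨x, y⟩ _ ⟨x', y'⟩ _ h
      simp only [Prod.mk.injEq] at h
      obtain ⟨h1, h2⟩ := h
      have hx : x = x' := by
        funext i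
        by_cases hi : i ∈ S
        · simpa [mix, hi] using congrFun h1 i
        · simpa [mix, hi] using congrFun h2 i
      have hy : y = y' := by
        funext i
        by_cases hi : i ∈ S
        · simpa [mix, hi] using congrFun h2 i
        · simpa [mix, hi] using congrFun h1 i
      rw [hx, hy]
    · rintro ⟨x', y'⟩ h'
      refine ⟨(mix S x' y', mix S y' x'), ?_, ?_⟩
      · simp only [mem_product, mem_filter, mem_univ, true_and, and_true] at h' ⊢
        refine ⟨?_, ?_⟩
        · rw [← h'.1]; exact hf _ _ (fun i hi => by simp [mix, hi])
        · rw [← h'.2]; exact hg _ _ (fun i hi => by simp [mix, hT i hi])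
      · ext i <;> by_cases hi : i ∈ S <;> simp [mix, hi]
  rw [card_product, card_product, card_univ_fun] at key
  unfold acc
  rw [← key, mul_comm]

/-- **Cylinder bound**: if `f` depends on `S` and takes the value `a` somewhere, it takes it on at
least `2^{N-|S|}` points. -/
theorem cylinder {f : (Fin N → Bool) → Bool} {S : Finset (Fin N)} (hf : DependsOn f S)
    {y : Fin N → Bool} {a : Bool} (hy : f y = a) : 2 ^ N ≤ 2 ^ S.card * acc f a := by
  classical
  have h1 : (univ : Finset (Fin N → Bool)).card ≤
      2 ^ S.card * ((univ : Finset (Fin N → Bool)).image (mix S y)).card :=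
    card_le_mul_card_image _ _ (fun z _ => card_filter_fibre_le S univ (mix S y)
      (fun x i hi => by simp [mix, hi]) z)
  have h2 : ((univ : Finset (Fin N → Bool)).image (mix S y)).card ≤ acc f a := by
    refine card_le_card fun z hz => ?_
    obtain ⟨x, -, rfl⟩ := mem_image.1 hz
    simp only [mem_filter, mem_univ, true_and]
    rw [← hy]
    exact hf _ _ (fun i hi => by simp [mix, hi])
  rw [card_univ_fun] at h1
  exact h1.trans (Nat.mul_le_mul_left _ h2)

/-- **Box product**: for a finite family of functions with pairwise disjoint supports, the number
of assignments meeting all the targets is the product of the individual counts (normalised).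
[folklore] -/
theorem box {σ : Type*} [DecidableEq σ] (R : Finset σ) (f : σ → (Fin N → Bool) → Bool)
    (S : σ → Finset (Fin N)) (t : σ → Bool) (hdep : ∀ i ∈ R, DependsOn (f i) (S i))
    (hdisj : ∀ i ∈ R, ∀ i' ∈ R, i ≠ i' → Disjoint (S i) (S i')) :
    2 ^ (N * R.card) * (univ.filter fun x => ∀ i ∈ R, f i x = t i).card =
      2 ^ N * ∏ i ∈ R, acc (f i) (t i) := by
  classical
  induction R using Finset.induction_on with
  | empty => simp
  | @insert a R haR ih =>
    have hdep' : ∀ i ∈ R, DependsOn (f i) (S i) := fun i hi => hdep i (mem_insert_of_mem hi)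
    have hdisj' : ∀ i ∈ R, ∀ i' ∈ R, i ≠ i' → Disjoint (S i) (S i') :=
      fun i hi i' hi' => hdisj i (mem_insert_of_mem hi) i' (mem_insert_of_mem hi')
    have ih' := ih hdep' hdisj'
    -- the conjunction over `R` as one Boolean function supported on `R.biUnion S`
    set g : (Fin N → Bool) → Bool := fun x => decide (∀ i ∈ R, f i x = t i) with hg
    have hgdep : DependsOn g (R.biUnion S) := by
      intro x y hxy
      simp only [hg]
      congr 1
      refine propext (forall₂_congr fun i hi => ?_)
      rw [hdep' i hi x y (fun q hq => hxy q (mem_biUnion.2 ⟨i, hi, hq⟩))]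
    have hdisj1 : Disjoint (S a) (R.biUnion S) := by
      rw [Finset.disjoint_biUnion_right]
      intro i hi
      exact hdisj a (mem_insert_self _ _) i (mem_insert_of_mem hi) (fun h => haR (h ▸ hi))
    have hI := indep (hdep a (mem_insert_self _ _)) hgdep hdisj1 (t a) true
    have hfilt : (univ.filter fun x => ∀ i ∈ insert a R, f i x = t i) =
        univ.filter fun x => f a x = t a ∧ g x = true := by
      refine filter_congr fun x _ => ?_
      simp [hg]
    have haccg : acc g true = (univ.filter fun x => ∀ i ∈ R, f i x = t i).card := by
      unfold acc
      congr 1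
      refine filter_congr fun x _ => ?_
      simp [hg]
    rw [hfilt, card_insert_of_notMem haR, prod_insert haR]
    calc 2 ^ (N * (R.card + 1)) * (univ.filter fun x => f a x = t a ∧ g x = true).card
        = 2 ^ (N * R.card) * (2 ^ N * (univ.filter fun x => f a x = t a ∧ g x = true).card) := by
          ring
      _ = 2 ^ (N * R.card) * (acc (f a) (t a) * acc g true) := by rw [hI]
      _ = acc (f a) (t a) * (2 ^ (N * R.card) *
            (univ.filter fun x => ∀ i ∈ R, f i x = t i).card) := by rw [haccg]; ring
      _ = acc (f a) (t a) * (2 ^ N * ∏ i ∈ R, acc (f i) (t i)) := by rw [ih']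
      _ = 2 ^ N * (acc (f a) (t a) * ∏ i ∈ R, acc (f i) (t i)) := by ring


end Counting

/-! ## §3 THE FLIP LAW for read-once formulas (kernel; new in g13)

For a read-once `F` (in any environment `ρ`) with base value `β = F(0^N)`, SILENT variables
`P = {p ∈ vars : F(e_p) = β}` and FLIPPING variables `Fl = vars ∖ P`:
`2^{2N+|P|} ≤ 2^{2|vars|}·acc(β)²` (silent law, g12's RO-LAW is the case `P = vars`) and, if
`Fl ≠ ∅`, `2^{2N+|Fl|} ≤ 2·2^{2|vars|}·acc(¬β)²` (flip law). In pattern units: `α² ≥ 2^{|P|}`,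
`2ᾱ² ≥ 2^{|Fl|}`. Exact product recursion over the tree (`acc_gate`), four sign cases per gate. -/

section FlipLaw

open Finset

variable {N : ℕ}

/-- The all-false input `0^N`. [folklore] -/
def x0 : Fin N → Bool := fun _ => false

/-- The point indicator `e_p`. [folklore] -/
def e (p : Fin N) : Fin N → Bool := fun i => decide (i = p)

/-- `0^N` is `false` everywhere. -/
@[simp] theorem x0_apply (i : Fin N) : (x0 : Fin N → Bool) i = false := rfl
/-- `e_p` is `true` at `p`. -/
@[simp] theorem e_apply_self (p : Fin N) : e p p = true := by simp [e]
/-- `e_p` is `false` off `p`. -/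
theorem e_apply_of_ne {p i : Fin N} (h : i ≠ p) : e p i = false := by simp [e, h]

/-- Silent variables of `f` inside `V`: flipping `p` alone does not change the base value. -/
def sil (f : (Fin N → Bool) → Bool) (V : Finset (Fin N)) : Finset (Fin N) :=
  V.filter fun p => f (e p) = f x0

/-- Flipping variables of `f` inside `V`. -/
def flp (f : (Fin N → Bool) → Bool) (V : Finset (Fin N)) : Finset (Fin N) :=
  V.filter fun p => f (e p) ≠ f x0

/-- Silent and flipping variables partition `V`. [folklore] -/
theorem sil_card_add_flp_card (f : (Fin N → Bool) → Bool) (V : Finset (Fin N)) :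
    (sil f V).card + (flp f V).card = V.card := by
  unfold sil flp
  exact Finset.card_filter_add_card_filter_not _

/-- `sil` commutes with unions. -/
theorem sil_union (f : (Fin N → Bool) → Bool) (V W : Finset (Fin N)) :
    sil f (V ∪ W) = sil f V ∪ sil f W := filter_union _ _ _

/-- `flp` commutes with unions. -/
theorem flp_union (f : (Fin N → Bool) → Bool) (V W : Finset (Fin N)) :
    flp f (V ∪ W) = flp f V ∪ flp f W := filter_union _ _ _

/-- `flp f V ⊆ V`. -/
theorem flp_subset (f : (Fin N → Bool) → Bool) (V : Finset (Fin N)) : flp f V ⊆ V := filter_subset _ _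
/-- `sil f V ⊆ V`. -/
theorem sil_subset (f : (Fin N → Bool) → Bool) (V : Finset (Fin N)) : sil f V ⊆ V := filter_subset _ _

/-- ONE SIDE OF A GATE: how the silent/flipping variables of the left child transfer to
`f = g(f_l, f_r)` when the right child is constant on the left child's indicators. [folklore] -/
theorem side_bounds (f fl fr : (Fin N → Bool) → Bool) (g : Bool → Bool → Bool)
    (hf : ∀ x, f x = g (fl x) (fr x)) (Vl : Finset (Fin N)) (hr : ∀ p ∈ Vl, fr (e p) = fr x0) :
    ((sil f Vl).card ≤
        (if g (! fl x0) (fr x0) = f x0 then Vl.card else (sil fl Vl).card)) ∧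
      (flp f Vl ⊆ flp fl Vl) ∧ (g (! fl x0) (fr x0) = f x0 → flp f Vl = ∅) := by
  have key : ∀ p ∈ Vl, fl (e p) ≠ fl x0 → f (e p) = g (! fl x0) (fr x0) := by
    intro p hp hne
    rw [hf, hr p hp, Bool.eq_not_iff.2 hne]
  have key' : ∀ p ∈ Vl, fl (e p) = fl x0 → f (e p) = f x0 := by
    intro p hp heq
    rw [hf, hf x0, hr p hp, heq]
  refine ⟨?_, ?_, ?_⟩
  · split_ifs with hs
    · exact card_le_card (sil_subset f Vl)
    · refine card_le_card fun p hp => ?_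
      simp only [sil, mem_filter] at hp ⊢
      refine ⟨hp.1, ?_⟩
      by_contra hne
      exact hs (by rw [← key p hp.1 hne, hp.2])
  · intro p hp
    simp only [flp, mem_filter] at hp ⊢
    exact ⟨hp.1, fun heq => hp.2 (key' p hp.1 heq)⟩
  · intro hs
    refine filter_eq_empty_iff.2 fun p hp hne => ?_
    by_cases heq : fl (e p) = fl x0
    · exact hne (key' p hp heq)
    · exact hne (by rw [key p hp heq, hs])

/-! ### Numeric helpers (all in `ℕ`) -/

/-- AM–GM in `ℕ`: `4xy ≤ (x+y)²`. -/
theorem four_mul_le_sq_add (x y : ℕ) : 4 * (x * y) ≤ (x + y) ^ 2 := by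
  have : (4 : ℤ) * (x * y) ≤ ((x : ℤ) + y) ^ 2 := by nlinarith [sq_nonneg ((x : ℤ) - y)]
  exact_mod_cast this

/-- Square roots are monotone in `ℕ`: `x² ≤ y² → x ≤ y`. -/
theorem le_of_sq_le_sq {x y : ℕ} (h : x ^ 2 ≤ y ^ 2) : x ≤ y :=
  (Nat.pow_le_pow_iff_left (by norm_num)).1 h

/-- product case: `ab ≤ 2^N γ` and the two inductive bounds give the bound for `γ`. -/
theorem num_prod {a b γ ca cb sa sb va vb : ℕ} (hab : a * b ≤ 2 ^ N * γ)
    (iha : 2 ^ (2 * N + sa) ≤ ca * 2 ^ (2 * va) * a ^ 2)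
    (ihb : 2 ^ (2 * N + sb) ≤ cb * 2 ^ (2 * vb) * b ^ 2) :
    2 ^ (2 * N + (sa + sb)) ≤ ca * cb * 2 ^ (2 * (va + vb)) * γ ^ 2 := by
  have h1 : (a * b) ^ 2 ≤ (2 ^ N * γ) ^ 2 := Nat.pow_le_pow_left hab 2
  have h2 := Nat.mul_le_mul iha ihb
  have hpos : 0 < 2 ^ (2 * N) := by positivity
  refine Nat.le_of_mul_le_mul_left ?_ hpos
  calc 2 ^ (2 * N) * 2 ^ (2 * N + (sa + sb))
      = 2 ^ (2 * N + sa) * 2 ^ (2 * N + sb) := by ring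
    _ ≤ ca * 2 ^ (2 * va) * a ^ 2 * (cb * 2 ^ (2 * vb) * b ^ 2) := h2
    _ = ca * cb * 2 ^ (2 * (va + vb)) * (a * b) ^ 2 := by ring
    _ ≤ ca * cb * 2 ^ (2 * (va + vb)) * (2 ^ N * γ) ^ 2 := Nat.mul_le_mul_left _ h1
    _ = 2 ^ (2 * N) * (ca * cb * 2 ^ (2 * (va + vb)) * γ ^ 2) := by ring

/-- absorbed case: `b ≤ γ` and the inductive bound for `b` give the bound with `va` extra. -/
theorem num_absorb {b γ cb sb va vb : ℕ} (hb : b ≤ γ)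
    (ihb : 2 ^ (2 * N + sb) ≤ cb * 2 ^ (2 * vb) * b ^ 2) :
    2 ^ (2 * N + (va + sb)) ≤ cb * 2 ^ (2 * (va + vb)) * γ ^ 2 := by
  have h1 : b ^ 2 ≤ γ ^ 2 := Nat.pow_le_pow_left hb 2
  have hva : 2 ^ va ≤ 2 ^ (2 * va) := Nat.pow_le_pow_right (by norm_num) (by omega)
  calc 2 ^ (2 * N + (va + sb)) = 2 ^ va * 2 ^ (2 * N + sb) := by ring
    _ ≤ 2 ^ (2 * va) * (cb * 2 ^ (2 * vb) * b ^ 2) := Nat.mul_le_mul hva ihb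
    _ ≤ 2 ^ (2 * va) * (cb * 2 ^ (2 * vb) * γ ^ 2) :=
        Nat.mul_le_mul_left _ (Nat.mul_le_mul_left _ h1)
    _ = cb * 2 ^ (2 * (va + vb)) * γ ^ 2 := by ring

/-- doubly absorbed case. -/
theorem num_absorb₂ {a b γ va vb : ℕ} (ha : a ≤ γ) (hb : b ≤ γ)
    (hA : 2 ^ N ≤ 2 ^ va * a) (hB : 2 ^ N ≤ 2 ^ vb * b) :
    2 ^ (2 * N + (va + vb)) ≤ 1 * 2 ^ (2 * (va + vb)) * γ ^ 2 := by
  have h := Nat.mul_le_mul hA hB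
  calc 2 ^ (2 * N + (va + vb)) = 2 ^ (va + vb) * (2 ^ N * 2 ^ N) := by ring
    _ ≤ 2 ^ (va + vb) * (2 ^ va * a * (2 ^ vb * b)) := Nat.mul_le_mul_left _ h
    _ = 2 ^ (2 * (va + vb)) * (a * b) := by ring
    _ ≤ 2 ^ (2 * (va + vb)) * (γ * γ) := Nat.mul_le_mul_left _ (Nat.mul_le_mul ha hb)
    _ = 1 * 2 ^ (2 * (va + vb)) * γ ^ 2 := by ring

/-- `a + ā = 2^N` with both halves of pattern-size `≥ 1` gives `2·2^v·aā ≥ 2^{2N}`. -/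
theorem num_halves {a a' va : ℕ} (hs : a + a' = 2 ^ N) (hA : 2 ^ N ≤ 2 ^ va * a)
    (hA' : 2 ^ N ≤ 2 ^ va * a') : 2 ^ (2 * N) ≤ 2 * 2 ^ va * (a * a') := by
  rcases le_total a a' with h | h
  · have h2 : 2 ^ N ≤ 2 * a' := by omega
    calc 2 ^ (2 * N) = 2 ^ N * 2 ^ N := by ring
      _ ≤ 2 ^ va * a * (2 * a') := Nat.mul_le_mul hA h2
      _ = 2 * 2 ^ va * (a * a') := by ring
  · have h2 : 2 ^ N ≤ 2 * a := by omega
    calc 2 ^ (2 * N) = 2 ^ N * 2 ^ N := by ring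
      _ ≤ 2 * a * (2 ^ va * a') := Nat.mul_le_mul h2 hA'
      _ = 2 * 2 ^ va * (a * a') := by ring

/-- two-flip case. -/
theorem num_twoflip {a a' b b' γ va vb fa fb : ℕ} (h : a' * b + a * b' ≤ 2 ^ N * γ)
    (hA : 2 ^ (2 * N) ≤ 2 * 2 ^ va * (a * a')) (hB : 2 ^ (2 * N) ≤ 2 * 2 ^ vb * (b * b'))
    (hfa : fa ≤ va) (hfb : fb ≤ vb) :
    2 ^ (2 * N + (fa + fb)) ≤ 2 * 2 ^ (2 * (va + vb)) * γ ^ 2 := by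
  have h1 : (a' * b + a * b') ^ 2 ≤ (2 ^ N * γ) ^ 2 := Nat.pow_le_pow_left h 2
  have h2 := four_mul_le_sq_add (a' * b) (a * b')
  have h3 := Nat.mul_le_mul hA hB
  have hf : 2 ^ (fa + fb) ≤ 2 ^ (va + vb) := Nat.pow_le_pow_right (by norm_num) (by omega)
  -- `2^{va+vb}·(2^N γ)² ≥ 2^{4N}`
  have h4 : 2 ^ (2 * N) * 2 ^ (2 * N) ≤ 2 ^ (va + vb) * (2 ^ N * γ) ^ 2 :=
    calc 2 ^ (2 * N) * 2 ^ (2 * N) ≤ 2 * 2 ^ va * (a * a') * (2 * 2 ^ vb * (b * b')) := h3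
      _ = 2 ^ (va + vb) * (4 * (a' * b * (a * b'))) := by ring
      _ ≤ 2 ^ (va + vb) * (a' * b + a * b') ^ 2 := Nat.mul_le_mul_left _ h2
      _ ≤ 2 ^ (va + vb) * (2 ^ N * γ) ^ 2 := Nat.mul_le_mul_left _ h1
  have hpos : 0 < 2 ^ (2 * N) := by positivity
  refine Nat.le_of_mul_le_mul_left ?_ hpos
  calc 2 ^ (2 * N) * 2 ^ (2 * N + (fa + fb)) = 2 ^ (fa + fb) * (2 ^ (2 * N) * 2 ^ (2 * N)) := by ring
    _ ≤ 2 ^ (va + vb) * (2 ^ (va + vb) * (2 ^ N * γ) ^ 2) := Nat.mul_le_mul hf h4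
    _ ≤ 2 * (2 ^ (va + vb) * (2 ^ (va + vb) * (2 ^ N * γ) ^ 2)) := Nat.le_mul_of_pos_left _ (by norm_num)
    _ = 2 ^ (2 * N) * (2 * 2 ^ (2 * (va + vb)) * γ ^ 2) := by ring

end FlipLaw

end Summit.PneNP.PneNP.Theorems.GapMCSPWindowCellZero
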